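import Mathlib.Analysis.Complex.Basic
import Mathlib.Analysis.Complex.OperatorNorm
import Mathlib.Analysis.Normed.Operator.Compact.Basic
import Mathlib.Analysis.Normed.Operator.Mul
import HarnessLib

/-!
# A complexification of a real Banach space, with the lift of bounded and compact operators

Analysis/OperatorTheory proofs-layer file (one theorem, no definitions, no named facts).

Every real normed space `E` embeds isometrically and `ℝ`-linearly as the "real part" of a complex
normed space `X` (complete when `E` is) in such a way that every bounded `ℝ`-linear operator
`A` on `E` extends to a bounded `ℂ`-linear operator `L A` on `X` with `‖L A‖ ≤ ‖A‖`, `L`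
additive, multiplicative and unital, `re ∘ L A = A ∘ re`, and `L A` compact when `A` is. This is
the standard complexification `E_ℂ = E ⊕ iE` (Taylor's norm; e.g. Muñoz–Sarantopoulos–Tonge 1999,
or Kato 1966, footnote to III-§6.1), which is what lets one apply the spectral theory of a complex
Banach algebra (resolvent, Riesz projections, Fredholm alternative) to a real operator.

Design. Mathlib (this pin) has no complexification of real normed spaces (searched
`omplexification`, `Complexification`: only Clifford algebras / inner-product remarks). Rather
than introducing a new type with instances (a reviewed definition), we state the outcome
EXISTENTIALLY over the type `X` and its instances — `exists_banach_complexification` — and realise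
it inside the proof on the Mathlib type `X := ℂ →L[ℝ] E` (an `ℝ`-linear map `ℂ → E` is the pair
`(f 1, f I)`), with the complex structure `(c • f) w := f (c w)` (a `Module ℂ` because `ℂ` is
commutative), the operator norm (for which `‖c • f‖ ≤ ‖c‖ ‖f‖`), `ι x := w ↦ (re w) • x`,
`re f := f 1`, and `L A := (f ↦ A ∘ f)`. Consumers quantify over an arbitrary complex Banach
space `X` with this interface, so no instance on a Mathlib type escapes the proof.

## References

* T. Kato, *Perturbation Theory for Linear Operators*, Springer 1966, III-§6.1 (complex
  extension of real operators). [Kato1966]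
-/

noncomputable section

open _root_.Complex

namespace Literature.Analysis.OperatorTheory

universe u

/-- **Complexification of a real normed space together with its bounded operators.** For every
real normed space `E` there are a complex normed space `X` (complete if `E` is), maps
`ι : E → X` (additive, `ℝ`-homogeneous, isometric), `re im : X → E` (`re` additive,
`ℝ`-homogeneous, norm-non-increasing, `re ∘ ι = id`, `re (I • ι x) = 0`,
`v = ι (re v) + I • ι (im v)`), and a lift `L` of bounded `ℝ`-linear operators on `E` to bounded
`ℂ`-linear operators on `X` which is additive, multiplicative, unital, norm-non-increasing,
satisfies `re (L A v) = A (re v)` and `L A (ι x) = ι (A x)`, and maps compact operators to compact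
operators. (Realised on `X = ℂ →L[ℝ] E` with `(c • f) w = f (c w)`.) [folklore] -/
theorem exists_banach_complexification (E : Type u) [NormedAddCommGroup E] [NormedSpace ℝ E] :
    ∃ (X : Type u) (_ : NormedAddCommGroup X) (_ : NormedSpace ℂ X),
      (CompleteSpace E → CompleteSpace X) ∧
      ∃ (ι : E → X) (re im : X → E) (L : (E →L[ℝ] E) → (X →L[ℂ] X)),
        (∀ x y, ι (x + y) = ι x + ι y) ∧ (∀ (r : ℝ) (x : E), ι (r • x) = (r : ℂ) • ι x) ∧
        (∀ x, ‖ι x‖ = ‖x‖) ∧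
        (∀ v w, re (v + w) = re v + re w) ∧ (∀ (r : ℝ) (v : X), re ((r : ℂ) • v) = r • re v) ∧
        (∀ v, ‖re v‖ ≤ ‖v‖) ∧ (∀ x, re (ι x) = x) ∧ (∀ x, re (I • ι x) = 0) ∧
        (∀ v, ι (re v) + I • ι (im v) = v) ∧
        (∀ A B, L (A + B) = L A + L B) ∧ (∀ A B, L (A * B) = L A * L B) ∧ (L 1 = 1) ∧
        (∀ A, ‖L A‖ ≤ ‖A‖) ∧ (∀ A v, re (L A v) = A (re v)) ∧ (∀ A x, L A (ι x) = ι (A x)) ∧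
        (∀ A : E →L[ℝ] E, IsCompactOperator A → IsCompactOperator (L A)) := by
  let X := ℂ →L[ℝ] E
  -- the complex structure `(c • f) w = f (c w)`
  letI mod : Module ℂ X :=
    { smul := fun c f => f.comp (ContinuousLinearMap.mul ℝ ℂ c)
      one_smul := fun f => by
        change f.comp (ContinuousLinearMap.mul ℝ ℂ 1) = f
        ext w; simp
      mul_smul := fun a b f => by
        change f.comp (ContinuousLinearMap.mul ℝ ℂ (a * b)) =
          (f.comp (ContinuousLinearMap.mul ℝ ℂ b)).comp (ContinuousLinearMap.mul ℝ ℂ a)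
        ext w; simp [mul_assoc, mul_left_comm]
      smul_zero := fun a => by
        change (0 : X).comp (ContinuousLinearMap.mul ℝ ℂ a) = 0
        ext w; simp
      smul_add := fun a f g => by
        change (f + g).comp (ContinuousLinearMap.mul ℝ ℂ a) =
          f.comp (ContinuousLinearMap.mul ℝ ℂ a) + g.comp (ContinuousLinearMap.mul ℝ ℂ a)
        ext w; simp
      add_smul := fun a b f => by
        change f.comp (ContinuousLinearMap.mul ℝ ℂ (a + b)) =
          f.comp (ContinuousLinearMap.mul ℝ ℂ a) + f.comp (ContinuousLinearMap.mul ℝ ℂ b)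
        ext w; simp
      zero_smul := fun f => by
        change f.comp (ContinuousLinearMap.mul ℝ ℂ 0) = 0
        ext w; simp }
  have smul_def : ∀ (c : ℂ) (f : X), c • f = f.comp (ContinuousLinearMap.mul ℝ ℂ c) :=
    fun _ _ => rfl
  have smul_apply : ∀ (c : ℂ) (f : X) (w : ℂ), (c • f) w = f (c * w) := fun _ _ _ => rfl
  letI ns : NormedSpace ℂ X :=
    ⟨fun c f => by
      rw [smul_def]
      refine (ContinuousLinearMap.opNorm_comp_le _ _).trans ?_
      rw [mul_comm]
      exact mul_le_mul_of_nonneg_right (ContinuousLinearMap.opNorm_mul_apply_le ℝ ℂ c)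
        (norm_nonneg _)⟩
  -- the data
  let ι : E → X := fun x => (reCLM : ℂ →L[ℝ] ℝ).smulRight x
  let re : X → E := fun f => f 1
  let im : X → E := fun f => f (-I)
  have ι_apply : ∀ (x : E) (w : ℂ), ι x w = w.re • x := fun x w => rfl
  -- the lift of an operator
  have lift_bound : ∀ (A : E →L[ℝ] E) (f : X), ‖A.comp f‖ ≤ ‖A‖ * ‖f‖ := fun A f =>
    ContinuousLinearMap.opNorm_comp_le _ _
  let L : (E →L[ℝ] E) → (X →L[ℂ] X) := fun A =>
    LinearMap.mkContinuous
      { toFun := fun f => A.comp f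
        map_add' := fun f g => by ext w; simp
        map_smul' := fun c f => by rw [RingHom.id_apply, smul_def, smul_def]; rfl }
      ‖A‖ (lift_bound A)
  have L_apply : ∀ (A : E →L[ℝ] E) (f : X), L A f = A.comp f := fun A f => rfl
  refine ⟨X, inferInstance, ns, fun _ => inferInstance, ι, re, im, L, ?_, ?_, ?_, ?_, ?_, ?_, ?_,
    ?_, ?_, ?_, ?_, ?_, ?_, ?_, ?_, ?_⟩
  · -- ι additive
    intro x y; ext w; simp [ι_apply]
  · -- ι ℝ-homogeneous
    intro r x; ext w
    rw [smul_apply, ι_apply, ι_apply, smul_smul]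
    congr 1
    simp [mul_comm]
  · -- ι isometric
    intro x
    change ‖(reCLM : ℂ →L[ℝ] ℝ).smulRight x‖ = ‖x‖
    rw [ContinuousLinearMap.norm_smulRight_apply, reCLM_norm, one_mul]
  · -- re additive
    intro v w; rfl
  · -- re ℝ-homogeneous
    intro r v
    change (((r : ℂ) • v) : X) 1 = r • v 1
    rw [smul_apply, mul_one, show ((r : ℂ)) = r • (1 : ℂ) by simp, map_smul]
  · -- ‖re v‖ ≤ ‖v‖
    intro v
    change ‖v 1‖ ≤ ‖v‖
    simpa using v.le_opNorm 1
  · -- re ∘ ι = id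
    intro x
    change ι x 1 = x
    rw [ι_apply]; simp
  · -- re (I • ι x) = 0
    intro x
    change (I • ι x) 1 = 0
    rw [smul_apply, ι_apply]; simp
  · -- decomposition
    intro v
    ext w
    change ι (v 1) w + (I • ι (v (-I))) w = v w
    rw [smul_apply, ι_apply, ι_apply, map_neg, smul_neg]
    have hv : v w = v ((w.re : ℂ) • (1 : ℂ) + (w.im : ℂ) • I) := by
      congr 1; simp
    rw [hv, map_add]
    rw [show ((w.re : ℂ) • (1 : ℂ)) = (w.re : ℝ) • (1 : ℂ) by simp,
      show ((w.im : ℂ) • I) = (w.im : ℝ) • I by simp, map_smul, map_smul]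
    simp
  · -- L additive
    intro A B; ext f w; simp [L_apply]
  · -- L multiplicative
    intro A B; ext f w; rfl
  · -- L unital
    ext f w; rfl
  · -- ‖L A‖ ≤ ‖A‖
    intro A
    exact LinearMap.mkContinuous_norm_le _ (norm_nonneg A) _
  · -- re (L A v) = A (re v)
    intro A v; rfl
  · -- L A (ι x) = ι (A x)
    intro A x; ext w
    change A (ι x w) = ι (A x) w
    rw [ι_apply, ι_apply, map_smul]
  · -- compactness
    intro A hA
    obtain ⟨K, hK, hAK⟩ := hA.image_closedBall_subset_compact (f := (A : E →ₗ[ℝ] E)) 1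
    -- `f = Φ (f 1, f I)` with `Φ` continuous
    let Φ : E × E → X := fun p =>
      (reCLM : ℂ →L[ℝ] ℝ).smulRight p.1 + (imCLM : ℂ →L[ℝ] ℝ).smulRight p.2
    have hΦc : Continuous Φ :=
      ((ContinuousLinearMap.smulRightL ℝ ℂ E (reCLM : ℂ →L[ℝ] ℝ)).continuous.comp
        continuous_fst).add
        ((ContinuousLinearMap.smulRightL ℝ ℂ E (imCLM : ℂ →L[ℝ] ℝ)).continuous.comp
          continuous_snd)
    have hΦ : ∀ f : X, Φ (f 1, f I) = f := by
      intro f; ext w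
      change w.re • f 1 + w.im • f I = f w
      have hv : f w = f ((w.re : ℝ) • (1 : ℂ) + (w.im : ℝ) • I) := by
        congr 1; simp
      rw [hv, map_add, map_smul, map_smul]
    refine (isCompactOperator_iff_exists_mem_nhds_image_subset_compact _).2
      ⟨Metric.closedBall 0 1, Metric.closedBall_mem_nhds _ one_pos, Φ '' (K ×ˢ K),
        (hK.prod hK).image hΦc, ?_⟩
    rintro _ ⟨f, hf, rfl⟩
    have hf' : ‖f‖ ≤ 1 := mem_closedBall_zero_iff.1 hf
    have h1 : A (f 1) ∈ K := by
      refine hAK ⟨f 1, mem_closedBall_zero_iff.2 ?_, rfl⟩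
      calc ‖f 1‖ ≤ ‖f‖ * ‖(1 : ℂ)‖ := f.le_opNorm 1
        _ ≤ 1 * 1 := by rw [norm_one, mul_one, mul_one]; exact hf'
        _ = 1 := mul_one 1
    have hI : A (f I) ∈ K := by
      refine hAK ⟨f I, mem_closedBall_zero_iff.2 ?_, rfl⟩
      calc ‖f I‖ ≤ ‖f‖ * ‖I‖ := f.le_opNorm I
        _ ≤ 1 * 1 := by rw [norm_I, mul_one, mul_one]; exact hf'
        _ = 1 := mul_one 1
    refine ⟨(A (f 1), A (f I)), Set.mk_mem_prod h1 hI, ?_⟩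
    exact hΦ (A.comp f)

end Literature.Analysis.OperatorTheory
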